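import Literature.AlgebraicGeometry.Morphisms.RefinedValuativeCriterion
import Mathlib.AlgebraicGeometry.IdealSheaf.Subscheme
import Mathlib.RingTheory.Ideal.Quotient.Nilpotent
import HarnessLib

/-!
# The refined valuative criterion (Stacks 0894) with `h(U)` merely dense

Topic: `Literature/AlgebraicGeometry/Morphisms`. The Stacks Project, Tag 0894 (Morphisms,
Lemma 29.43.2) assumes of `h : U → X` only that it is quasi-compact with `h(U)` DENSE in `X`; the
tree's `universallyClosed_of_valuativeCriterion_comp` (`RefinedValuativeCriterion.lean`) proves
the universal-closedness conclusion for `h` scheme-theoretically dominant and records the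
preliminary reduction of the printed proof ("pass to reductions") as a TODO. This file carries
out that reduction, which is needed in the proof of Nagata's compactification theorem (Tag 0F40
is applied with `U₁ ∩ U₂` merely dense in `U`, for non-reduced `U`): replace `X` by its reduction
`X_red = V(nil(𝒪_X)) ↪ X` (a surjective closed immersion, so `f` is universally closed iff
`X_red → X → S` is, Mathlib `UniversallyClosed.of_comp_surjective`) and `U` by `U_red`; the induced
`U_red → X_red` is quasi-compact and dominant, hence scheme-theoretically dominant (`X_red` is
reduced), and every lift `Spec A → X` of a valuative square factors through `X_red` (`A` is a
domain).

* `isReduced_subscheme_nilradical` — `X_red` is reduced; `nilradical_le_ker` — a morphism from a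
  reduced scheme kills the nilradical; `reduce h : U_red → X_red`;
* `universallyClosed_of_valuativeCriterion_comp_of_denseRange`,
  `isProper_of_valuativeCriterion_comp_of_denseRange` — **Stacks 0894** with `h` quasi-compact of
  dense image and `f` quasi-compact separated (resp. also locally of finite type).

## References

* The Stacks Project, Tag 0894 (Morphisms, Lemma 29.43.2), proof, first paragraph. [StacksProject]
-/

noncomputable section

universe u

open CategoryTheory CategoryTheory.Limits AlgebraicGeometry TopologicalSpace

namespace Literature.AlgebraicGeometry.Morphisms

/-! ## The reduction `X_red` -/

section Reduction

variable (X : Scheme.{u})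

/-- **`X_red = V(nil 𝒪_X)` is reduced**: it is covered by the spectra of the reduced rings
`Γ(X, U) ⧸ nil Γ(X, U)`. [cite: StacksProject, Tag 01IZ] -/
instance isReduced_subscheme_nilradical : IsReduced X.nilradical.subscheme := by
  haveI : ∀ U : X.affineOpens, _root_.IsReduced (Γ(X, U) ⧸ X.nilradical.ideal U) := fun U => by
    rw [← Ideal.isRadical_iff_quotient_reduced, Scheme.nilradical, Scheme.IdealSheafData.radical_ideal,
      Scheme.IdealSheafData.ideal_bot, Pi.bot_apply]
    exact Ideal.radical_isRadical _
  haveI : ∀ i : X.affineOpens, IsReduced ((X.nilradical.subschemeCover.openCover).X i) := fun i =>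
    inferInstanceAs (IsReduced (Spec (.of (Γ(X, i) ⧸ X.nilradical.ideal i))))
  exact IsReduced.of_openCover (X := X.nilradical.subscheme) X.nilradical.subschemeCover.openCover

/-- `X_red → X` is surjective. [cite: StacksProject, Tag 01IZ] -/
instance surjective_subschemeι_nilradical : Surjective X.nilradical.subschemeι :=
  ⟨fun x => by
    have hx : x ∈ Set.range X.nilradical.subschemeι := by
      rw [Scheme.IdealSheafData.range_subschemeι, Scheme.support_nilradical]; trivial
    exact hx⟩

variable {X}

/-- **A morphism from a reduced scheme kills the nilradical**: `nil(𝒪_X) ≤ ker l` for `l : T → X`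
with `T` reduced (a nilpotent section pulls back to a nilpotent, hence zero, section).
[folklore] -/
theorem nilradical_le_ker {T : Scheme.{u}} [IsReduced T] (l : T ⟶ X) : X.nilradical ≤ l.ker := by
  rw [Scheme.Hom.ker, Scheme.IdealSheafData.le_ofIdeals_iff]
  intro U s hs
  rw [Scheme.nilradical, Scheme.IdealSheafData.radical_ideal, Scheme.IdealSheafData.ideal_bot,
    Pi.bot_apply] at hs
  obtain ⟨n, hn⟩ := hs
  rw [RingHom.mem_ker]
  have h : ((l.app U).hom s) ^ n = 0 := by rw [← map_pow, hn, map_zero]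
  exact IsNilpotent.eq_zero ⟨n, h⟩

variable {U : Scheme.{u}} (h : U ⟶ X)

/-- **The reduction `U_red → X_red` of `h : U → X`.** [cite: StacksProject, Tag 0894 (proof)] -/
def reduce : U.nilradical.subscheme ⟶ X.nilradical.subscheme :=
  IsClosedImmersion.lift X.nilradical.subschemeι (U.nilradical.subschemeι ≫ h) (by
    rw [Scheme.IdealSheafData.ker_subschemeι]
    exact nilradical_le_ker _)

/-- `U_red → X_red → X = U_red → U → X`. [folklore] -/
@[reassoc (attr := simp)]
theorem reduce_ι : reduce h ≫ X.nilradical.subschemeι = U.nilradical.subschemeι ≫ h :=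
  IsClosedImmersion.lift_fac _ _ _

/-- `U_red → X_red` is quasi-compact if `h` is. [folklore] -/
instance quasiCompact_reduce [QuasiCompact h] : QuasiCompact (reduce h) := by
  haveI : QuasiCompact (reduce h ≫ X.nilradical.subschemeι) := by rw [reduce_ι]; infer_instance
  exact .of_comp _ X.nilradical.subschemeι

/-- `U_red → X_red` is dominant if `h(U)` is dense (`X_red → X` is a homeomorphism). [folklore] -/
theorem isDominant_reduce (hd : DenseRange h) : IsDominant (reduce h) := by
  refine ⟨?_⟩
  have hι := X.nilradical.subschemeι.isClosedEmbedding.isInducing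
  have hr : Set.range (fun x => X.nilradical.subschemeι (reduce h x)) = Set.range h := by
    ext y
    simp only [Set.mem_range]
    constructor
    · rintro ⟨x, rfl⟩
      refine ⟨U.nilradical.subschemeι x, ?_⟩
      rw [← Scheme.Hom.comp_apply, ← Scheme.Hom.comp_apply, reduce_ι]
    · rintro ⟨x', rfl⟩
      obtain ⟨x, rfl⟩ := (surjective_subschemeι_nilradical U).1 x'
      refine ⟨x, ?_⟩
      rw [← Scheme.Hom.comp_apply, reduce_ι, Scheme.Hom.comp_apply]
  rw [DenseRange, hι.dense_iff]
  intro x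
  rw [← Set.range_comp]
  change _ ∈ closure (Set.range fun x => X.nilradical.subschemeι (reduce h x))
  rw [hr, hd.closure_eq]
  trivial

end Reduction

/-! ## Stacks 0894 with dense image -/

section Criterion

variable {U X S : Scheme.{u}} (h : U ⟶ X) (f : X ⟶ S)

/-- **Stacks 0894 (refined valuative criterion), universal closedness, with `h(U)` merely dense.**
Let `h : U → X` be quasi-compact with dense image and `f : X → S` quasi-compact and separated. If
every valuative square whose `K`-point comes from `U` has a lift, then `f` is universally closed.
[cite: StacksProject, Tag 0894] -/
theorem universallyClosed_of_valuativeCriterion_comp_of_denseRange [QuasiCompact h] (hd : DenseRange h)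
    [QuasiCompact f] [IsSeparated f]
    (H : ∀ ⦃A K : Type u⦄ [CommRing A] [IsDomain A] [ValuationRing A] [Field K] [Algebra A K]
      [IsFractionRing A K] (u : Spec (.of K) ⟶ U) (s : Spec (.of A) ⟶ S),
      u ≫ h ≫ f = Spec.map (CommRingCat.ofHom (algebraMap A K)) ≫ s →
      ∃ l : Spec (.of A) ⟶ X, Spec.map (CommRingCat.ofHom (algebraMap A K)) ≫ l = u ≫ h ∧
        l ≫ f = s) :
    UniversallyClosed f := by
  haveI : IsDominant (reduce h) := isDominant_reduce h hd
  haveI : IsSchemeTheoreticallyDominant (reduce h) := IsSchemeTheoreticallyDominant.of_isDominant _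
  haveI : UniversallyClosed (X.nilradical.subschemeι ≫ f) := by
    refine universallyClosed_of_valuativeCriterion_comp (reduce h) (X.nilradical.subschemeι ≫ f) ?_
    intro A K _ _ _ _ _ _ u s hsq
    obtain ⟨l, hl₁, hl₂⟩ := H (u ≫ U.nilradical.subschemeι) s (by
      rw [Category.assoc, ← hsq, reduce_ι_assoc])
    refine ⟨IsClosedImmersion.lift X.nilradical.subschemeι l
      (by rw [Scheme.IdealSheafData.ker_subschemeι]; exact nilradical_le_ker l), ?_, ?_⟩
    · rw [← cancel_mono X.nilradical.subschemeι]
      simp only [Category.assoc, IsClosedImmersion.lift_fac, reduce_ι]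
      rw [hl₁, Category.assoc]
    · rw [← Category.assoc, IsClosedImmersion.lift_fac, hl₂]
  exact UniversallyClosed.of_comp_surjective X.nilradical.subschemeι f

/-- **Stacks 0894, properness form, with `h(U)` merely dense.** [cite: StacksProject, Tag 0894] -/
theorem isProper_of_valuativeCriterion_comp_of_denseRange [QuasiCompact h] (hd : DenseRange h)
    [QuasiCompact f] [IsSeparated f] [LocallyOfFiniteType f]
    (H : ∀ ⦃A K : Type u⦄ [CommRing A] [IsDomain A] [ValuationRing A] [Field K] [Algebra A K]
      [IsFractionRing A K] (u : Spec (.of K) ⟶ U) (s : Spec (.of A) ⟶ S),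
      u ≫ h ≫ f = Spec.map (CommRingCat.ofHom (algebraMap A K)) ≫ s →
      ∃ l : Spec (.of A) ⟶ X, Spec.map (CommRingCat.ofHom (algebraMap A K)) ≫ l = u ≫ h ∧
        l ≫ f = s) :
    IsProper f :=
  haveI := universallyClosed_of_valuativeCriterion_comp_of_denseRange h f hd H
  { }

end Criterion

end Literature.AlgebraicGeometry.Morphisms

end
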